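import Summits.HodgeConjecture.HodgeConjecture.Theorems.HeckePrymWeilSemiregularSpreadOfBlochLifts
import Literature.AlgebraicGeometry.HodgeTheory.BlochSemiregularSpread
import Literature.AlgebraicGeometry.HodgeTheory.ProperOverQuasiProjective
import Literature.AlgebraicGeometry.HodgeTheory.RegularImmersionCodim
import Literature.AlgebraicGeometry.HodgeTheory.RegularImmersionConormal
import Literature.AlgebraicGeometry.HodgeTheory.RegularImmersionIso
import Literature.AlgebraicGeometry.HodgeTheory.SupportedClassesSemipurity
import Literature.AlgebraicGeometry.HodgeTheory.FibreRestrictionsLocallyConstantRank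
import Literature.AlgebraicGeometry.HodgeTheory.DirectImageBaseChangeSections
import Literature.AlgebraicGeometry.HodgeTheory.GysinFormalismCorrespondences
import Literature.AlgebraicGeometry.HodgeTheory.IsoTransport
import HarnessLib

/-!
# Venture HSemireg — bridge (B1): the class-level named fact `BlochSemiregularSpread n p` from the OBJECT-level facts,
# modulo exactly the isomorphism-invariance of Bloch semiregularity

HONEST FRAMING. Interface file of the computation cell `pub-hsemireg`, track «S4-PUSH» (iii), seat s4-bridge-1 (bridge (B1)).
NOTHING about any explicit variety is asserted; nothing here says that HC, HC_CM or HC_AV is proved. THEOREMS ONLY: no `def`, no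
named fact, no `sorry`, no new axiom; every input is a hypothesis BY NAME or an explicitly displayed hypothesis.

## What this file proves

The S4 lane's lci door consumes Bloch's (7.4)/(7.5) through the CLASS-level named fact `BlochSemiregularSpread n p`
(`Literature/AlgebraicGeometry/HodgeTheory/BlochSemiregularSpread.lean`; consumers `HasBlochSeedAt`, `HasHyperbolicBlochSeed`,
`TwelvefoldDoor`), whose seed `i : Z ↪ X₀` lives on a MODEL `e : X₀ ≅ 𝒳_{s₀}` of the fibre (where census rows compute). The tree
also holds the two OBJECT-level facts `Bloch1972_semiregularSubschemeLifts` (Bloch (7.1) + Hilbert point + Artin) and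
`fulton1998_flatFamily_cycleClass_specialises` (Fulton 10.1/19.2), whose seed lives in THE fibre. `SemiregularityTheoremsObjectLevel.lean`
(C-v4) showed that, for a seed IN the fibre, the binder lists agree except for the model isomorphism. HERE the last bookkeeping is
done and the residual gap is DISPLAYED AS A HYPOTHESIS:

* `blochSemiregularSpread_of_blochLifts_of_fulton_of_isoInvariance` — **`BlochSemiregularSpread n p` holds, granted the two
  object-level facts AND the isomorphism-invariance of Bloch semiregularity** `hT`: for every isomorphism `φ : X₀ ≅ X₁` of
  `ℂ`-schemes and every `i : Z ⟶ X₀`, `IsBlochSemiregular i n p → IsBlochSemiregular (i ≫ φ) n p`. The transport of everything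
  ELSE along the model isomorphism `e` is proved here from tree theorems: the lci predicate (`IsRegularImmersionOfCodim.comp_iso`,
  `RegularImmersionIso.lean`), whence «conormal sheaf finite locally free» (`….isFiniteLocallyFree_conormalSheaf`,
  `RegularImmersionConormal.lean`) and «codimension `≥ p`» (`….le_coheight`, `RegularImmersionCodim.lean`) in the fibre; the
  supported class (`x = e^*(W|_{X₀'})` supported on `i(Z)` ⟹ `W|_{X₀'}` supported on `(i ≫ e)(Z)`, by
  `complexBetti.restrictCompl_map_eq_zero` along `e⁻¹`); «`f` projective» from quasi-projectivity (`ProperOverQuasiProjective.lean`);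
  and Bloch's codimension dichotomy (a point of codimension `p` ⟹ the kernel `HeckePrymWeilLine.semiregularSpread_of_blochLifts_of_fulton`;
  else `W|_{X₀'} ∈ N^{p+1}H^{2p} = 0` by semipurity and the flat section vanishes near `s₀`, Ehresmann). The rationality half of
  `BlochSemiregularSpread`'s horizontality binder is not used.

WHY `hT` IS A HYPOTHESIS AND NOT A THEOREM: `IsBlochSemiregular i n p` (`BlochSemiregularityMapReal.lean`) is the surjectivity of
Bloch's pairing map `H^{m-1}(X₀, Ω^{m+1}) → H^{m-1}(X₀, 𝓐lt_{p-1}(𝓘; Ωⁿ|_Z))` built from the Hodge sheaves `Ωʲ_{X₀/ℂ}`, the ideal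
module of `i` and Mathlib's `Sheaf.H`; its invariance under an isomorphism of the AMBIENT scheme is mathematically empty but needs the
iso-functoriality of `hodgeCohomology`, `idealModule`, `formsOnSubscheme`, `altMultiHom`, `blochPairingAltSheafHom` and of `Sheaf.H`
under the induced equivalence of sheaf categories — none of which the tree has (the tree's `HigherSigmaOfIso.lean` transports
Buchweitz–Flenner `σ` along isomorphisms of MODULES on a FIXED scheme only). So this file turns the (B1) provenance sentence «the
class-level fact = the object-level facts + transport along the model iso» into a kernel-checked implication with the transport as
its only displayed premise.

References: [Bloch1972Semiregularity] Thm. (7.1) p. 64, Thm. (7.4) and Remark (7.5) p. 65; [BuchweitzFlenner2003] Thm. 5.2, (8.1),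
Prop. 8.2; [Fulton1998] §10.1, §19.1–19.2; [GortzWedhorn2023] Def. 19.19/19.23, Rem. 19.22; [BrunsHerzog1998] §1.2 Prop. 1.2.12/1.2.14;
[GrothendieckTopology1969] §1 (semipurity); [VoisinHodgeII2003] §3.1.2 (flat sections); [Hartshorne1977] II §4 (projective morphisms).
-/

noncomputable section

open CategoryTheory CategoryTheory.Limits AlgebraicGeometry Opposite TopologicalSpace RingTheory.Sequence
open Literature.AlgebraicGeometry.Motives Literature.AlgebraicGeometry.HodgeTheory
open Literature.AlgebraicGeometry.Deformation

namespace Summit.Ventures.HSemireg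

namespace Bloch1972

local notation3 (prettyPrint := false) "Res[" f ", " s ", " k ", " A "]" =>
  complexBetti.map (Literature.AlgebraicGeometry.Motives.fiberι f s) k A

/-- **`BlochSemiregularSpread n p` from the object-level Bloch fact + Fulton's fact, modulo EXACTLY the isomorphism-invariance of
Bloch semiregularity.** The class-level named fact (Bloch 1972 (7.4)/(7.5) = Buchweitz–Flenner Thm. 5.2 at `I = {p}`, printed:
«If there is an `I`-semiregular subspace `Z₀ ⊆ X₀` with `α_p(0) = ch_p(𝒪_{Z₀})` for `p ∈ I` then `α_p(s)` is algebraic for all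
`s ∈ S` near `0`»; rendering in `BlochSemiregularSpread.lean`: smooth projective family `f : 𝒳 ⟶ S` of relative dimension `n`,
`𝒳`, `S` quasi-projective, `S` smooth, `s₀ ∈ S(ℂ)`, MODEL `e : X₀ ≅ 𝒳_{s₀}`, `i : Z ↪ X₀` an integral local complete intersection
of codimension `p` (`IsRegularImmersionOfCodim i p`, `p ≤ coheight` pointwise) which is Bloch-semiregular, `x` supported on `Z`,
`W` a global class fibrewise rational of type `(p,p)` with `e^*(W|_{𝒳_{s₀}}) = x` ⟹ `W|_{𝒳_t}` algebraic for `t` in an open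
`U ∋ s₀`) FOLLOWS from `Bloch1972_semiregularSubschemeLifts` ((7.1) + Hilbert point + Artin: an étale-local flat family through
the semiregular `Z₀ ⊆ 𝒳_{s₀}`), `fulton1998_flatFamily_cycleClass_specialises` (the fibre classes of a flat family are restrictions
of one global class) and the displayed hypothesis `hT` = invariance of `IsBlochSemiregular` under isomorphisms of the ambient
`ℂ`-scheme (see the module docstring for why this is a hypothesis). Proof: read the seed in THE fibre through `e`
(`IsRegularImmersionOfCodim.comp_iso`; then `….isFiniteLocallyFree_conormalSheaf`, `….le_coheight` in the locally Noetherian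
fibre; the supported class along `e⁻¹` by `complexBetti.restrictCompl_map_eq_zero`; semiregularity by `hT`); «`f` projective»
from quasi-projectivity; then Bloch's dichotomy — a point of codimension `p`: the kernel composition
`HeckePrymWeilLine.semiregularSpread_of_blochLifts_of_fulton`; none: `W|_{𝒳_{s₀}} ∈ N^{p+1}H^{2p} = 0` (semipurity) and the
flat section vanishes on an open neighbourhood of `s₀` (Ehresmann), where `0` is algebraic. Trust base: `hBl`, `hFu`, `hT`.
[cite: Bloch1972Semiregularity, Thm. (7.4) and Remark (7.5) p. 65, Thm. (7.1) p. 64]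
[cite: BuchweitzFlenner2003, Thm. 5.2; (8.1) and Prop. 8.2] [cite: Fulton1998, §10.1 Cor. 10.1; §19.1 Lemma 19.1.1; §19.2 Cor. 19.2 (b)]
[cite: GortzWedhorn2023, Def. 19.19, Def. 19.23 and Rem. 19.22] [cite: BrunsHerzog1998, §1.2 Prop. 1.2.12 and Prop. 1.2.14]
[cite: GrothendieckTopology1969, §1 (N^c H^i = 0 for i < 2c)] [cite: VoisinHodgeII2003, §3.1.2]
[cite: Hartshorne1977, II §4 (p. 103) and Cor. 4.8 (e)] -/
theorem blochSemiregularSpread_of_blochLifts_of_fulton_of_isoInvariance (n p : ℕ)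
    (hT : ∀ (X₀ X₁ : SchemeOver ℂ) (φ : X₀ ≅ X₁) (Z : Scheme.{0}) (i : Z ⟶ X₀.left) (n p : ℕ),
      IsBlochSemiregular i n p → IsBlochSemiregular (i ≫ φ.hom.left) n p)
    (hBl : Bloch1972_semiregularSubschemeLifts) (hFu : fulton1998_flatFamily_cycleClass_specialises) :
    BlochSemiregularSpread n p := by
  intro X₀ Z i x 𝒳 S f s₀ e W hi hreg hZ hcodim hsr hx hf h𝒳 hS hSm hW hWx
  classical
  haveI := hSm
  haveI := hZ
  -- the seed read in THE fibre `X₀' := 𝒳_{s₀}` through the model isomorphism `e`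
  let φ : X₀.left ≅ (fiberOver f s₀).left := (Over.forget _).mapIso e
  let i₀ : Z ⟶ (fiberOver f s₀).left := i ≫ φ.hom
  have hreg₀ : IsRegularImmersionOfCodim i₀ p := hreg.comp_iso φ
  haveI : IsClosedImmersion i₀ := hreg₀.isClosedImmersion
  have hsr₀ : IsBlochSemiregular i₀ n p := hT X₀ (fiberOver f s₀) e Z i n p hsr
  haveI : IsLocallyNoetherian (fiberOver f s₀).left :=
    IsSmoothProjective.isLocallyNoetherian_holds (hf.isSmoothProjective s₀)
  have hlci₀ : IsFiniteLocallyFree (conormalSheaf i₀) := hreg₀.isFiniteLocallyFree_conormalSheaf i₀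
  have hcoh₀ : ∀ z : Z, (p : ℕ∞) ≤ Order.coheight (i₀.base z) := hreg₀.le_coheight
  -- the class: `W|_{X₀'}` is supported on `i₀(Z)` (transport of `x = e^*(W|_{X₀'})` back along `e⁻¹`)
  have hih : ∀ y, φ.hom.base (φ.inv.base y) = y := fun y ↦ Scheme.inv_hom_apply φ y
  have hhi : ∀ w, φ.inv.base (φ.hom.base w) = w := fun w ↦ Scheme.hom_inv_apply φ w
  have hset : φ.inv.base ⁻¹' Set.range i.base = Set.range i₀.base := by
    ext y
    constructor
    · rintro ⟨z, hz⟩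
      refine ⟨z, ?_⟩
      change φ.hom.base (i.base z) = y
      rw [hz, hih]
    · rintro ⟨z, rfl⟩
      refine ⟨z, ?_⟩
      change i.base z = φ.inv.base (φ.hom.base (i.base z))
      rw [hhi]
  have hsupp₀ : Res[f, s₀, 2 * p, W] ∈ classesSupportedOn (fiberOver f s₀) (Set.range i₀.base) (2 * p) := by
    have h1 : complexBetti.restrictCompl X₀ (Set.range i.base) (2 * p) x = 0 := LinearMap.mem_ker.1 hx
    have h2 := complexBetti.restrictCompl_map_eq_zero e.inv h1
    rw [← hWx, e.complexBetti_map_inv_map_hom] at h2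
    change Res[f, s₀, 2 * p, W] ∈ LinearMap.ker (complexBetti.restrictCompl (fiberOver f s₀) (Set.range i₀.base) (2 * p)).hom
    rw [LinearMap.mem_ker, ← hset]
    exact h2
  have hW' : ∀ s : ComplexPoints S,
      IsOfHodgeType n (fiberOver f s) (2 * p) p p (Res[f, s, 2 * p, W]) := fun s ↦ (hW s).2
  -- «f projective» from quasi-projectivity
  have hproj := h𝒳.exists_isClosedImmersion_projectiveSpace_tensor_of_isSmoothProjectiveFamily f hf
  -- the two cases of Bloch's dichotomy
  by_cases hcohp : ∃ z : Z, Order.coheight (i₀.base z) = (p : ℕ∞)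
  · exact Summit.HodgeConjecture.HodgeConjecture.Theorems.HeckePrymWeilLine.semiregularSpread_of_blochLifts_of_fulton
      hBl hFu f n p hf hproj hSm s₀ Z i₀ inferInstance hlci₀ hZ hcoh₀ hcohp hsr₀ W hW' hsupp₀
  · push Not at hcohp
    have hcoh' : ∀ z ∈ Set.range i₀.base, ((p + 1 : ℕ) : ℕ∞) ≤ Order.coheight z := by
      rintro _ ⟨z, rfl⟩
      rw [Nat.cast_add_one]
      exact Order.add_one_le_of_lt (lt_of_le_of_ne (hcoh₀ z) (Ne.symm (hcohp z)))
    have hW0 : Res[f, s₀, 2 * p, W] = 0 := by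
      have h := classesSupportedOn_le_supportedClasses i₀.isClosedEmbedding.isClosed_range hcoh'
        (2 * p) hsupp₀
      rw [supportedClasses_eq_bot_of_lt (hf.isSmoothProjective s₀)
        (show 2 * p < 2 * (p + 1) by omega)] at h
      exact (Submodule.mem_bot ℂ).1 h
    have hE := isCohomologicallyLocallyTrivialOn_univ_of_isSmoothProjectiveFamily_of_smooth f hf
    refine ⟨{s | s ∈ Set.univ ∧ Res[f, s, 2 * p, W] = 0},
      isOpen_setOf_map_fiberι_eq_zero hE W, ⟨Set.mem_univ _, hW0⟩, fun t ht ↦ ?_⟩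
    rw [ht.2]
    exact Submodule.zero_mem _


end Bloch1972

end Summit.Ventures.HSemireg

end
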